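import Mathlib
import HarnessLib
import Summits.AtomisticToContinuum.Crystallization.Theorems.ChartedPlanarOrderRigidityDoor

/-!
# Density dichotomy beneath `R⋆` = `DiscreteBarlowRigidity` (decomp-a2c, lens 2 «structural dichotomy», g21)

TARGET OF RECORD: the registered residual `R⋆` = `stmt-AtomisticToContinuum-28120`
(`ChartedPlanarOrderRigidityDoor.DiscreteBarlowRigidity`, by name; text
`ChartedPlanarOrderDiscreteBarlowRigidity.DiscreteBarlowRigidityExpanded`):

  `∀ δ>0 ∃ c>0 ∃ C≥0 ∃ r>0 ∀ θ ∈ (0,1/16] ∀ S δ-sep ∀ K ⊆ S finite clean: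
      c·θ²·#bad_θ(K) ≤ Σ_{x∈K}(e_x(S) − e⋆) + C·#bdry_r(K)`.

## The node (all pieces over the `RigidityDoor` vocabulary BY NAME; 0 sorry)

Two observations drive the cut.

(A) **The roof is over-strong for its only consumer.**  The kernel `sparseMisfit_of_rigidity` uses `R⋆`
    at ONE tolerance `θ = ν` and divides by `R³`; it never uses the `θ`-uniformity of `(c, C, r)` nor the
    absence of a bulk error.  The FLAT roof

      `R⋆♭ = DiscreteBarlowRigidityFlat :
         ∀ δ ∀ θ ∃ c>0 ∀ ε>0 ∃ C r ∀ S K clean, c·#bad_θ(K) ≤ Σ(e_x − e⋆) + C·#bdry_r(K) + ε·#K`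

    feeds the SAME door: `sparseMisfit_of_flat : R⋆♭ → BindingSurface → WindowCounting → SparseMisfit ν`
    (kernel K5 below, with the packing count `#atomsIn ≤ (2/δ+1)³R³`).  `R⋆ ⟹ R⋆♭` (K1); the converse is
    not claimed (R⋆♭ is WEAKER-or-equal; the `ε·#K` slack is exactly what a compactness / Følner
    argument can deliver, the `ε = 0`, `θ`-uniform roof is of quantitative-rigidity (FJM) strength).

(B) **Special vs generic = dilute vs dense defects.**  `R⋆♭` splits along the DEFECT DENSITY
    `u = #bad_θ(K)/#K` of the chunk:

      `R⋆♭ ⟸ ChunkFloor ∧ DefectDensityRate`                       (K3; and `R⋆♭ ⟹ DefectDensityRate`, K2)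
      `DefectDensityRate ⟸ BulkDefectGap ∧ DiluteDefectRate`        (K4; both converses hold, K4')

    * `ChunkFloor` (Floor♭, the defect-free / `c = 0` end): `0 ≤ Σ(e_x−e⋆) + C#bdry_r + ε#K` for ALL finite
      chunks — PROVED in the companion helper `Theorems/ChartedPlanarOrderChunkFloor.lean` (`chunkFloor`,
      0 sorry; text-identical, bridge `chunkFloor_iff_text` below is `Iff.rfl`).  STRICTLY WEAKER (true).
    * `DefectDensityRate` (RATE′): the linear law `c·#bad ≤ Σ(e−e⋆) + C_u·#bdry_{r_u}` demanded only on
      chunks of defect density `≥ u`, constants allowed to degrade as `u ↓ 0`.  WEAKER-or-equal.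
    * `BulkDefectGap` (GENERIC / dense branch, GAP class): density `≥ u` forces a bulk energy density
      `η(u)·#K` — an energy-GAP statement for configurations with a positive density of visible defects;
      concordant with the law-level `VisibleGap` through Følner transfer.  WEAKER than RATE′ (K4').
    * `DiluteDefectRate` (SPECIAL / dilute branch, quantitative-rigidity class): the linear law only for
      defect densities `≤ u⋆(δ,θ)` — isolated defects in a near-perfect layered Barlow bulk, where
      linearisation about the matched templates is available.  WEAKER than RATE′ (K4').  NEW RESIDUAL.

    The exhaustion `u ≤ u⋆ ∨ u > u⋆` is trivial; the two branches belong to DIFFERENT technique classes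
    (variational gap vs. discrete Gårding / FJM), which is the point of the lens.

## Tags
  R⋆  ⟸ (not split at ε = 0; see (A))            R⋆♭ : WEAKER-or-equal, consumed roof (K5)
  ChunkFloor : WEAKER, PROVED (helper file)       DefectDensityRate : WEAKER-or-equal (⟺ Bulk ∧ Dilute)
  BulkDefectGap : WEAKER, UNDECIDED, INSTRUMENTABLE (periodic supercell census: min energy density at
                  defect density ≥ u), IDEA: Følner transfer from `VisibleGap`-type law statements
  DiluteDefectRate : WEAKER, UNDECIDED, ATTACKABLE-XL (linearised stability of Barlow stackings + discrete
                  Korn/Gårding on clean two-shell chunks), INSTRUMENTABLE (single-defect supercells)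
  Leaves: BARRIER none catalogued applies (no complex weights, no thresholds: all constants existential).

## Kernels (this file + `…DensityDichotomyDoor.lean`, 0 sorry)
  K1 `flat_of_rigidity`        : R⋆ → R⋆♭
  K2 `rate_of_flat`            : R⋆♭ → RATE′
  K3 `flat_of_floor_rate`      : ChunkFloor → RATE′ → R⋆♭
  K4 `rate_of_bulk_dilute`     : BULK → DILUTE → RATE′ ;  K4' `bulk_of_rate`, `dilute_of_rate`
  K5 `sparseMisfit_of_flat`    : R⋆♭ → BindingSurface → WindowCounting → SparseMisfit ν  (0 < ν ≤ 1/16)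
  K6 `gap_and_pert_1_50_of_flat` : DOOR → SparseNull(≤1/16) → R⋆♭ → BindingSurface → WindowCounting →
                                   VisibleGap (1/50) ∧ PertRegime (1/50)
  so that beneath the door the residual of record becomes  ChunkFloor (✓) ∧ BulkDefectGap ∧ DiluteDefectRate.
  (K5, K6 and the packing count `nK_atomsIn_le` live in the companion module
  `Theorems/ChartedPlanarOrderDensityDichotomyDoor.lean`, same namespace — split off at landing for the 400-line lint.)
-/

noncomputable section

open MeasureTheory Set Metric
open Summit.AtomisticToContinuum.Crystallization.Theorems.ChartedPlanarOrderRigidityDoor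

namespace Summit.AtomisticToContinuum.Crystallization.Theorems.ChartedPlanarOrderDensityDichotomy

/-! ## 1. Chunk vocabulary (abbreviations over `RigidityDoor`) -/

/-- the counting measure of a configuration `S`. -/
abbrev μS (S : Set E3) : Measure E3 := (Measure.count : Measure E3).restrict S

/-- `S` is `δ`-separated. -/
def IsSep (δ : ℝ) (S : Set E3) : Prop := ∀ x ∈ S, ∀ y ∈ S, x ≠ y → δ ≤ dist x y

/-- `K` is a finite chunk of `S` of (1/16, 9/10, 1)-two-shell-clean atoms (R⋆'s binders, verbatim). -/
def IsCleanChunk (S K : Set E3) : Prop :=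
  K ⊆ S ∧ K.Finite ∧ ∀ x ∈ K, Literature.Geometry.DiscreteGeometry.IsTwoShellGoodSet (1 / 16) (9 / 10) 1 S x

/-- the site-energy excess of the chunk: `Σᶠ_{x∈K} (e_x(S) − e⋆)`. -/
def excess (S K : Set E3) : ℝ := ∑ᶠ x ∈ K, (siteEnergy (μS S) x - eStar)

/-- number of `θ`-unmatched atoms of the chunk. -/
def nBad (θ : ℝ) (S K : Set E3) : ℝ := (Set.ncard (badIn θ (μS S) K) : ℝ)

/-- number of atoms of the chunk in its `r`-boundary layer. -/
def nBdry (r : ℝ) (S K : Set E3) : ℝ := (Set.ncard (bdryIn r (μS S) K) : ℝ)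

/-- number of atoms of the chunk. -/
def nK (K : Set E3) : ℝ := (Set.ncard K : ℝ)

/-- `#bad ≥ 0`. -/
theorem nBad_nonneg (θ : ℝ) (S K : Set E3) : 0 ≤ nBad θ S K := Nat.cast_nonneg _
/-- `#bdry ≥ 0`. -/
theorem nBdry_nonneg (r : ℝ) (S K : Set E3) : 0 ≤ nBdry r S K := Nat.cast_nonneg _
/-- `#K ≥ 0`. -/
theorem nK_nonneg (K : Set E3) : 0 ≤ nK K := Nat.cast_nonneg _

/-- `#bad ≤ #K` for a finite chunk. -/
theorem nBad_le_nK (θ : ℝ) {S K : Set E3} (hK : K.Finite) : nBad θ S K ≤ nK K := by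
  unfold nBad nK
  exact_mod_cast Set.ncard_le_ncard (fun p (hp : p ∈ badIn θ (μS S) K) => hp.1) hK

/-- the boundary layer grows with `r`. -/
theorem nBdry_mono {r r' : ℝ} (h : r ≤ r') {S K : Set E3} (hK : K.Finite) : nBdry r S K ≤ nBdry r' S K := by
  unfold nBdry
  refine Nat.cast_le.2 (Set.ncard_le_ncard ?_ (hK.subset fun p hp => hp.1))
  rintro p ⟨hpK, y, hy, hyK, hd⟩
  exact ⟨hpK, y, hy, hyK, hd.trans h⟩

/-! ## 2. THE PIECES -/

/-- **R⋆♭ «DiscreteBarlowRigidityFlat»** — the FLAT roof (WEAKER-or-equal than R⋆; consumed by the door exactly like R⋆, K5):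
per tolerance `θ` a rate `c(δ,θ) > 0`, and for every bulk slack `ε > 0` constants `C, r` with
`c·#bad_θ(K) ≤ Σ_{x∈K}(e_x − e⋆) + C·#bdry_r(K) + ε·#K` on clean finite chunks. -/
def DiscreteBarlowRigidityFlat : Prop :=
  ∀ δ : ℝ, 0 < δ → ∀ θ : ℝ, 0 < θ → θ ≤ 1 / 16 → ∃ c : ℝ, 0 < c ∧ ∀ ε : ℝ, 0 < ε →
    ∃ C : ℝ, 0 ≤ C ∧ ∃ r : ℝ, 0 < r ∧ ∀ S K : Set E3, IsSep δ S → IsCleanChunk S K →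
      c * nBad θ S K ≤ excess S K + C * nBdry r S K + ε * nK K

/-- **Floor♭ «ChunkFloor»** (WEAKER, TRUE — proved in `Theorems/ChartedPlanarOrderChunkFloor.lean`): every finite chunk of a
`δ`-separated configuration costs at least `e⋆` per site up to a boundary term and an arbitrarily small bulk density.  No cleanliness. -/
def ChunkFloor : Prop :=
  ∀ δ : ℝ, 0 < δ → ∀ ε : ℝ, 0 < ε → ∃ C : ℝ, 0 ≤ C ∧ ∃ r : ℝ, 0 < r ∧
    ∀ S : Set E3, IsSep δ S → ∀ K : Set E3, K ⊆ S → K.Finite →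
      0 ≤ excess S K + C * nBdry r S K + ε * nK K

/-- **RATE′ «DefectDensityRate»** (WEAKER-or-equal than R⋆♭): the linear defect law, demanded only on chunks of defect density
`#bad/#K ≥ u`, with constants `C, r` allowed to degrade as `u ↓ 0` (the rate `c` is uniform in `u`). -/
def DefectDensityRate : Prop :=
  ∀ δ : ℝ, 0 < δ → ∀ θ : ℝ, 0 < θ → θ ≤ 1 / 16 → ∃ c : ℝ, 0 < c ∧ ∀ u : ℝ, 0 < u → u ≤ 1 →
    ∃ C : ℝ, 0 ≤ C ∧ ∃ r : ℝ, 0 < r ∧ ∀ S K : Set E3, IsSep δ S → IsCleanChunk S K →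
      u * nK K ≤ nBad θ S K → c * nBad θ S K ≤ excess S K + C * nBdry r S K

/-- **BULK «BulkDefectGap»** — the GENERIC (dense-defect) branch, GAP class (WEAKER than RATE′): a density `≥ u` of `θ`-unmatched atoms
forces a bulk excess-energy density `η(δ,θ,u) > 0`, up to a boundary term. -/
def BulkDefectGap : Prop :=
  ∀ δ : ℝ, 0 < δ → ∀ θ : ℝ, 0 < θ → θ ≤ 1 / 16 → ∀ u : ℝ, 0 < u → u ≤ 1 →
    ∃ η : ℝ, 0 < η ∧ ∃ C : ℝ, 0 ≤ C ∧ ∃ r : ℝ, 0 < r ∧ ∀ S K : Set E3, IsSep δ S → IsCleanChunk S K →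
      u * nK K ≤ nBad θ S K → η * nK K ≤ excess S K + C * nBdry r S K

/-- **DILUTE «DiluteDefectRate»** — the SPECIAL (dilute-defect) branch, quantitative-rigidity class (WEAKER than RATE′; the NEW
RESIDUAL): below a threshold density `u⋆(δ,θ)`, i.e. for isolated visible defects in an otherwise matched layered-Barlow bulk, each defect
costs `≥ c`, up to a boundary term whose constants may degrade with the lower density `u`. -/
def DiluteDefectRate : Prop :=
  ∀ δ : ℝ, 0 < δ → ∀ θ : ℝ, 0 < θ → θ ≤ 1 / 16 → ∃ u₀ : ℝ, 0 < u₀ ∧ u₀ ≤ 1 ∧ ∃ c : ℝ, 0 < c ∧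
    ∀ u : ℝ, 0 < u → u ≤ u₀ → ∃ C : ℝ, 0 ≤ C ∧ ∃ r : ℝ, 0 < r ∧ ∀ S K : Set E3, IsSep δ S → IsCleanChunk S K →
      u * nK K ≤ nBad θ S K → nBad θ S K ≤ u₀ * nK K → c * nBad θ S K ≤ excess S K + C * nBdry r S K

/-! ## 3. Bridges to the texts of record -/

/-- R⋆ by name, unfolded into the chunk vocabulary. -/
theorem rstar_apply (hR : DiscreteBarlowRigidity) {δ : ℝ} (hδ : 0 < δ) :
    ∃ c : ℝ, 0 < c ∧ ∃ C : ℝ, 0 ≤ C ∧ ∃ r : ℝ, 0 < r ∧ ∀ θ : ℝ, 0 < θ → θ ≤ 1 / 16 →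
      ∀ S K : Set E3, IsSep δ S → IsCleanChunk S K →
        c * θ ^ 2 * nBad θ S K ≤ excess S K + C * nBdry r S K := by
  obtain ⟨c, hc, C, hC, r, hr, h⟩ := hR δ hδ
  exact ⟨c, hc, C, hC, r, hr, fun θ hθ hθ' S K hS hK => h θ hθ hθ' S hS K hK.1 hK.2.1 hK.2.2⟩

/-- `ChunkFloor` is, by `rfl`, the def-free text proved as `ChartedPlanarOrderChunkFloor.chunkFloor` (companion helper file). -/
theorem chunkFloor_iff_text :
    ChunkFloor ↔
      ∀ δ : ℝ, 0 < δ → ∀ ε : ℝ, 0 < ε → ∃ C : ℝ, 0 ≤ C ∧ ∃ r : ℝ, 0 < r ∧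
        ∀ S : Set E3, (∀ x ∈ S, ∀ y ∈ S, x ≠ y → δ ≤ dist x y) →
          ∀ K : Set E3, K ⊆ S → K.Finite →
            0 ≤ (∑ᶠ x ∈ K, ((∫ y, Literature.MathematicalPhysics.StatisticalMechanics.lennardJones ‖y - x‖
                    ∂((Measure.count : Measure E3).restrict S)) / 2 -
                    ⨅ Q : Literature.MathematicalPhysics.StatisticalMechanics.PeriodicConfiguration 3,
                      Q.energyPerParticle Literature.MathematicalPhysics.StatisticalMechanics.lennardJones)) +
                C * (Set.ncard {p : E3 | p ∈ K ∧ ∃ y : E3,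
                      ((Measure.count : Measure E3).restrict S) {y} ≠ 0 ∧ y ∉ K ∧ dist p y ≤ r} : ℝ) +
                ε * (Set.ncard K : ℝ) :=
  Iff.rfl

/-! ## 4. KERNELS (0 sorry) -/

/-- **K1** `R⋆ ⟹ R⋆♭` (rate `c·θ²`, drop the bulk slack). -/
theorem flat_of_rigidity (hR : DiscreteBarlowRigidity) : DiscreteBarlowRigidityFlat := by
  intro δ hδ θ hθ hθ'
  obtain ⟨c, hc, C, hC, r, hr, h⟩ := rstar_apply hR hδ
  refine ⟨c * θ ^ 2, by positivity, fun ε hε => ⟨C, hC, r, hr, fun S K hS hK => ?_⟩⟩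
  have h1 := h θ hθ hθ' S K hS hK
  have h2 : 0 ≤ ε * nK K := mul_nonneg hε.le (nK_nonneg K)
  linarith

/-- **K2** `R⋆♭ ⟹ RATE′` (at density `≥ u` take the slack `ε = c·u/2` and absorb it: rate `c/2`). -/
theorem rate_of_flat (hF : DiscreteBarlowRigidityFlat) : DefectDensityRate := by
  intro δ hδ θ hθ hθ'
  obtain ⟨c, hc, h⟩ := hF δ hδ θ hθ hθ'
  refine ⟨c / 2, by positivity, fun u hu _ => ?_⟩
  obtain ⟨C, hC, r, hr, h'⟩ := h (c * u / 2) (by positivity)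
  refine ⟨C, hC, r, hr, fun S K hS hK hdense => ?_⟩
  have h1 := h' S K hS hK
  have h2 : c * u / 2 * nK K ≤ c / 2 * nBad θ S K := by nlinarith [hdense, hc.le]
  linarith

/-- **K3** `Floor♭ ∧ RATE′ ⟹ R⋆♭` — the density dichotomy at threshold `u = min 1 (ε/(2c))`: dense chunks by RATE′, dilute chunks by
the floor (their few defects are paid by half the bulk slack). -/
theorem flat_of_floor_rate (hFl : ChunkFloor) (hRa : DefectDensityRate) : DiscreteBarlowRigidityFlat := by
  intro δ hδ θ hθ hθ'
  obtain ⟨c, hc, h⟩ := hRa δ hδ θ hθ hθ'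
  refine ⟨c, hc, fun ε hε => ?_⟩
  -- threshold density
  set u : ℝ := min 1 (ε / (2 * c)) with hu
  have hu0 : 0 < u := lt_min one_pos (by positivity)
  have hu1 : u ≤ 1 := min_le_left _ _
  have huε : c * u ≤ ε / 2 := by
    have : u ≤ ε / (2 * c) := min_le_right _ _
    rw [le_div_iff₀ (by positivity)] at this
    linarith
  obtain ⟨C₁, hC₁, r₁, hr₁, hdense⟩ := h u hu0 hu1
  obtain ⟨C₂, hC₂, r₂, hr₂, hfloor⟩ := hFl δ hδ (ε / 2) (by positivity)
  refine ⟨max C₁ C₂, le_max_of_le_left hC₁, max r₁ r₂, lt_max_of_lt_left hr₁, fun S K hS hK => ?_⟩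
  have hKf : K.Finite := hK.2.1
  have hb1 : nBdry r₁ S K ≤ nBdry (max r₁ r₂) S K := nBdry_mono (le_max_left _ _) hKf
  have hb2 : nBdry r₂ S K ≤ nBdry (max r₁ r₂) S K := nBdry_mono (le_max_right _ _) hKf
  have hbn : 0 ≤ nBdry (max r₁ r₂) S K := nBdry_nonneg _ _ _
  have hKn : 0 ≤ nK K := nK_nonneg K
  have hBn : 0 ≤ nBad θ S K := nBad_nonneg _ _ _
  rcases le_or_gt (u * nK K) (nBad θ S K) with hd | hd
  · -- dense chunk
    have h1 := hdense S K hS hK hd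
    have h2 : C₁ * nBdry r₁ S K ≤ max C₁ C₂ * nBdry (max r₁ r₂) S K :=
      (mul_le_mul_of_nonneg_left hb1 hC₁).trans (mul_le_mul_of_nonneg_right (le_max_left _ _) hbn)
    nlinarith [h1, h2, mul_nonneg hε.le hKn]
  · -- dilute chunk
    have h1 := hfloor S hS K hK.1 hKf
    have h2 : C₂ * nBdry r₂ S K ≤ max C₁ C₂ * nBdry (max r₁ r₂) S K :=
      (mul_le_mul_of_nonneg_left hb2 hC₂).trans (mul_le_mul_of_nonneg_right (le_max_right _ _) hbn)
    have h3 : c * nBad θ S K ≤ ε / 2 * nK K := by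
      have : c * nBad θ S K ≤ c * (u * nK K) := mul_le_mul_of_nonneg_left hd.le hc.le
      nlinarith [this, huε, hKn]
    linarith

/-- **K4** `BULK ∧ DILUTE ⟹ RATE′` — the special/generic dichotomy: below the dilute threshold `u₀` the dilute rate, above it the bulk gap
(using `#bad ≤ #K`); rate `min c η(u₀)`. -/
theorem rate_of_bulk_dilute (hB : BulkDefectGap) (hD : DiluteDefectRate) : DefectDensityRate := by
  intro δ hδ θ hθ hθ'
  obtain ⟨u₀, hu₀, hu₀1, c, hc, hdil⟩ := hD δ hδ θ hθ hθ'
  obtain ⟨η, hη, Cb, hCb, rb, hrb, hbulk⟩ := hB δ hδ θ hθ hθ' u₀ hu₀ hu₀1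
  refine ⟨min c η, lt_min hc hη, fun u hu hu1 => ?_⟩
  -- dilute constants at the density `min u u₀`
  obtain ⟨Cd, hCd, rd, hrd, hdil'⟩ := hdil (min u u₀) (lt_min hu hu₀) (min_le_right _ _)
  refine ⟨max Cb Cd, le_max_of_le_left hCb, max rb rd, lt_max_of_lt_left hrb, fun S K hS hK hdense => ?_⟩
  have hKf : K.Finite := hK.2.1
  have hb1 : nBdry rb S K ≤ nBdry (max rb rd) S K := nBdry_mono (le_max_left _ _) hKf
  have hb2 : nBdry rd S K ≤ nBdry (max rb rd) S K := nBdry_mono (le_max_right _ _) hKf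
  have hbn : 0 ≤ nBdry (max rb rd) S K := nBdry_nonneg _ _ _
  have hKn : 0 ≤ nK K := nK_nonneg K
  have hBn : 0 ≤ nBad θ S K := nBad_nonneg _ _ _
  have hBK : nBad θ S K ≤ nK K := nBad_le_nK θ hKf
  have hmin1 : min c η ≤ c := min_le_left _ _
  have hmin2 : min c η ≤ η := min_le_right _ _
  have hmin0 : 0 ≤ min c η := (lt_min hc hη).le
  rcases le_or_gt (nBad θ S K) (u₀ * nK K) with hcase | hcase
  · -- special branch: dilute defects
    have hlow : min u u₀ * nK K ≤ nBad θ S K := (mul_le_mul_of_nonneg_right (min_le_left _ _) hKn).trans hdense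
    have h1 := hdil' S K hS hK hlow hcase
    have h2 : Cd * nBdry rd S K ≤ max Cb Cd * nBdry (max rb rd) S K :=
      (mul_le_mul_of_nonneg_left hb2 hCd).trans (mul_le_mul_of_nonneg_right (le_max_right _ _) hbn)
    have h3 : min c η * nBad θ S K ≤ c * nBad θ S K := mul_le_mul_of_nonneg_right hmin1 hBn
    linarith
  · -- generic branch: a positive density of defects
    have h1 := hbulk S K hS hK hcase.le
    have h2 : Cb * nBdry rb S K ≤ max Cb Cd * nBdry (max rb rd) S K :=
      (mul_le_mul_of_nonneg_left hb1 hCb).trans (mul_le_mul_of_nonneg_right (le_max_left _ _) hbn)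
    have h3 : min c η * nBad θ S K ≤ η * nK K :=
      (mul_le_mul_of_nonneg_right hmin2 hBn).trans (mul_le_mul_of_nonneg_left hBK hη.le)
    linarith

/-- **K4'a** `RATE′ ⟹ BULK` (η = c·u). -/
theorem bulk_of_rate (hRa : DefectDensityRate) : BulkDefectGap := by
  intro δ hδ θ hθ hθ' u hu hu1
  obtain ⟨c, hc, h⟩ := hRa δ hδ θ hθ hθ'
  obtain ⟨C, hC, r, hr, h'⟩ := h u hu hu1
  refine ⟨c * u, by positivity, C, hC, r, hr, fun S K hS hK hdense => ?_⟩
  have h1 := h' S K hS hK hdense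
  nlinarith [hdense, hc.le]

/-- **K4'b** `RATE′ ⟹ DILUTE` (u₀ = 1, the upper density bound unused). -/
theorem dilute_of_rate (hRa : DefectDensityRate) : DiluteDefectRate := by
  intro δ hδ θ hθ hθ'
  obtain ⟨c, hc, h⟩ := hRa δ hδ θ hθ hθ'
  refine ⟨1, one_pos, le_rfl, c, hc, fun u hu hu1 => ?_⟩
  obtain ⟨C, hC, r, hr, h'⟩ := h u hu hu1
  exact ⟨C, hC, r, hr, fun S K hS hK hdense _ => h' S K hS hK hdense⟩

/-- hence `RATE′ ⟺ BULK ∧ DILUTE` and `R⋆♭ ⟺ Floor♭ ∧ RATE′` given the (proved) floor. -/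
theorem rate_iff_bulk_and_dilute : DefectDensityRate ↔ BulkDefectGap ∧ DiluteDefectRate :=
  ⟨fun h => ⟨bulk_of_rate h, dilute_of_rate h⟩, fun h => rate_of_bulk_dilute h.1 h.2⟩

/-- Given Floor♭, `R⋆♭ ⟺ RATE′` (K2 + K3). -/
theorem flat_iff_rate_of_floor (hFl : ChunkFloor) : DiscreteBarlowRigidityFlat ↔ DefectDensityRate :=
  ⟨rate_of_flat, flat_of_floor_rate hFl⟩

/-- the node beneath R⋆♭ in one line:  Floor♭ ∧ BULK ∧ DILUTE ⟹ R⋆♭. -/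
theorem flat_of_floor_bulk_dilute (hFl : ChunkFloor) (hB : BulkDefectGap) (hD : DiluteDefectRate) :
    DiscreteBarlowRigidityFlat :=
  flat_of_floor_rate hFl (rate_of_bulk_dilute hB hD)

/-! ## 6. Census-facing SPECIAL instance: homogeneous stackings (the g20 cut HBC, re-typed by name; NOT an item)

Under the density cut a homogeneously deformed flexible-gap stacking is matched everywhere or nowhere at a given tolerance (up to
boundary effects), so the lineage's g20 special piece HBC lands inside the `u = 1` instance of BULK.  These defs are the precise
targets of the certified-lattice-sum plan (critic order (b)); kernels show they are kernel-weaker than R⋆ / BULK. -/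

open Literature.MathematicalPhysics.StatisticalMechanics
  (triangularVec₁ triangularVec₂ haggLabel barlowOffset layerNormal IsHaggSeq)

/-- The homogeneously deformed flexible-gap stacking: the image under a linear map `L` of the layered template with in-plane
spacing `1`, Hägg word `s` and height profile `z` (scale, rotation and strain all sit in `L`). [g20 `HomStacking`, verbatim] -/
def HomStacking (L : E3 →L[ℝ] E3) (s : ℤ → ℤ) (z : ℤ → ℝ) : Set E3 :=
  {p | ∃ m i j : ℤ, p = L (((i : ℝ) • triangularVec₁ 1) + ((j : ℝ) • triangularVec₂ 1) +
    ((haggLabel s m : ℝ) • barlowOffset 1) + (z m • layerNormal 1))}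

/-- **HBC «HomogeneousBarlowCoercivity»** (g20's SPECIAL piece, by name over `RigidityDoor`): R⋆'s inequality with R⋆'s
quantifier prefix, asserted only for `S = HomStacking L s z` (`s` Hägg). -/
def HomogeneousBarlowCoercivity : Prop :=
  ∀ δ : ℝ, 0 < δ → ∃ c : ℝ, 0 < c ∧ ∃ C : ℝ, 0 ≤ C ∧ ∃ r : ℝ, 0 < r ∧ ∀ θ : ℝ, 0 < θ → θ ≤ 1 / 16 →
    ∀ (L : E3 →L[ℝ] E3) (s : ℤ → ℤ) (z : ℤ → ℝ), IsHaggSeq s → IsSep δ (HomStacking L s z) →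
      ∀ K : Set E3, IsCleanChunk (HomStacking L s z) K →
        c * θ ^ 2 * nBad θ (HomStacking L s z) K ≤ excess (HomStacking L s z) K + C * nBdry r (HomStacking L s z) K

/-- **HBG «HomogeneousBulkGap»** — the census-facing target of the certified-lattice-sum plan: the `u = 1` instance of BULK on
homogeneous stackings: a clean chunk of a Hägg stacking `HomStacking L s z` ALL of whose atoms are `θ`-unmatched has excess-energy
density `≥ η(δ,θ) > 0` up to a boundary term («a clean homogeneous stacking that is θ-unmatched costs η per site»). -/
def HomogeneousBulkGap : Prop :=
  ∀ δ : ℝ, 0 < δ → ∀ θ : ℝ, 0 < θ → θ ≤ 1 / 16 → ∃ η : ℝ, 0 < η ∧ ∃ C : ℝ, 0 ≤ C ∧ ∃ r : ℝ, 0 < r ∧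
    ∀ (L : E3 →L[ℝ] E3) (s : ℤ → ℤ) (z : ℤ → ℝ), IsHaggSeq s → IsSep δ (HomStacking L s z) →
      ∀ K : Set E3, IsCleanChunk (HomStacking L s z) K → nK K ≤ nBad θ (HomStacking L s z) K →
        η * nK K ≤ excess (HomStacking L s z) K + C * nBdry r (HomStacking L s z) K

/-- R⋆ ⇒ HBC (restriction to homogeneous stackings). -/
theorem hbc_of_rigidity (hR : DiscreteBarlowRigidity) : HomogeneousBarlowCoercivity := by
  intro δ hδ
  obtain ⟨c, hc, C, hC, r, hr, h⟩ := rstar_apply hR hδ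
  exact ⟨c, hc, C, hC, r, hr, fun θ hθ hθ' L s z _ hS K hK => h θ hθ hθ' _ K hS hK⟩

/-- BULK ⇒ HBG (the `u = 1` instance, restricted to homogeneous stackings). -/
theorem homBulk_of_bulk (hB : BulkDefectGap) : HomogeneousBulkGap := by
  intro δ hδ θ hθ hθ'
  obtain ⟨η, hη, C, hC, r, hr, h⟩ := hB δ hδ θ hθ hθ' 1 one_pos le_rfl
  refine ⟨η, hη, C, hC, r, hr, fun L s z _ hS K hK hall => h _ K hS hK ?_⟩
  simpa using hall

/-- HBC ⇒ HBG (with `η = c·θ²`: on an all-bad chunk `c·θ²·#bad ≥ c·θ²·#K`). -/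
theorem homBulk_of_hbc (hH : HomogeneousBarlowCoercivity) : HomogeneousBulkGap := by
  intro δ hδ θ hθ hθ'
  obtain ⟨c, hc, C, hC, r, hr, h⟩ := hH δ hδ
  refine ⟨c * θ ^ 2, by positivity, C, hC, r, hr, fun L s z hs hS K hK hall => ?_⟩
  have key := h θ hθ hθ' L s z hs hS K hK
  have hcθ : 0 ≤ c * θ ^ 2 := by positivity
  calc c * θ ^ 2 * nK K ≤ c * θ ^ 2 * nBad θ (HomStacking L s z) K :=
        mul_le_mul_of_nonneg_left hall hcθ
    _ ≤ _ := key

/-- Hence R⋆ ⇒ HBG along either side of the square. -/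
theorem homBulk_of_rigidity (hR : DiscreteBarlowRigidity) : HomogeneousBulkGap :=
  homBulk_of_hbc (hbc_of_rigidity hR)

end Summit.AtomisticToContinuum.Crystallization.Theorems.ChartedPlanarOrderDensityDichotomy

end
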